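import Literature.Analysis.FluidPDE.LerayGaugeStrainSpectrum
import Mathlib.Analysis.Matrix.Spectrum
import HarnessLib

/-!
# `MustSqueeze` — the pointwise velocity-gradient algebra (sign law and middle-eigenvalue bound)

Helper file for item stmt-NavierStokesRegularity-11610 (route SqueezeCycle, crux `MustSqueeze`).
Pure `3 × 3` linear algebra of a trace-free velocity-gradient matrix `M = (∂ⱼuᵢ)ᵢⱼ` with
vorticity vector `ω = (M₂₁ − M₁₂, M₀₂ − M₂₀, M₁₀ − M₀₁)` and strain `S = ½ (M + Mᵀ)`:

* `curlVec_dotProduct_mulVec_eq_det` — Betchov's **sign law** `ω·Mω = 4 det M − 4 det S`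
  (R. Betchov, J. Fluid Mech. 1 (1956) 497–504, §3, and E. Miller, Arch. Ration. Mech. Anal.
  235 (2020) 99–139 = `Miller2019`, §1: `det ∇u = det S + ¼ ω·Sω` for the decomposition
  `∇u = S + ½[ω]ₓ`; a polynomial identity, no trace condition needed);
* `sum_sq_half_add_transpose` — `‖S‖²_F = ½‖M‖²_F + ½ tr(M²)`;
* `curlVec_dotProduct_self` — `|ω|² = ‖M‖²_F − tr(M²)`;
* `neg_det_half_add_transpose_le` — the **middle-eigenvalue bound** `−4 det S ≤ 2a ‖S‖²_F`
  whenever `tr M = 0`, `0 ≤ a` and the middle eigenvalue of `S` is `≤ a` (Mathlib's decreasingly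
  sorted `Matrix.IsHermitian.eigenvalues₀` of `M + Mᵀ = 2S`, index `1`, is `≤ 2a`): with the
  eigenvalues `λ₁ ≥ λ₂ ≥ λ₃` of `S`, `∑ λᵢ = 0`, this is `−4λ₁λ₂λ₃ ≤ 2λ₂⁺ ∑ λᵢ²`
  (J. Neustupa, P. Penel, in: *Mathematical Fluid Mechanics*, Birkhäuser 2001, 237–265 =
  `NeustupaPenel2001`; E. Miller, `Miller2019`, §1: `−det S ≤ ½ λ₂⁺|S|²`);
* `curlVec_dotProduct_mulVec_le` — the combination used by the enstrophy estimate,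
  `ω·Mω ≤ 4 det M + a (‖M‖²_F + tr(M²))`;
* `inner_apply_curl_le` — the same for a linear map `A` of `ℝ³` (`M = stdMatrix A`,
  `ω = curl`), through the tree's `strainEigenvalues` / `frobeniusNormSq`.
-/

noncomputable section

open Matrix Finset
open scoped RealInnerProductSpace BigOperators

namespace Summit.NavierStokesRegularity.NavierStokesRegularity.Theorems

open Literature.Analysis.FluidPDE

/-- Local notation for physical space `ℝ³ = EuclideanSpace ℝ (Fin 3)`. -/
local notation "ℝ³" => EuclideanSpace ℝ (Fin 3)

/-- **Betchov's sign law** `ω·Mω = 4 det M − 4 det S`, `S = ½(M + Mᵀ)`, for every real `3 × 3`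
matrix `M` with vorticity vector `ω = (M₂₁ − M₁₂, M₀₂ − M₂₀, M₁₀ − M₀₁)`: the local enstrophy
production splits into the null Lagrangian `4 det ∇u` and the strain determinant. A polynomial
identity (`det(S + W) = det S + wᵀSw` for `W = [w]ₓ`, `ω = 2w`). [cite: Miller2019, §1 (enstrophy identity via det S and tr S³)] -/
theorem curlVec_dotProduct_mulVec_eq_det (M : Matrix (Fin 3) (Fin 3) ℝ) :
    (![M 2 1 - M 1 2, M 0 2 - M 2 0, M 1 0 - M 0 1] : Fin 3 → ℝ) ⬝ᵥ (M *ᵥ (![M 2 1 - M 1 2, M 0 2 - M 2 0, M 1 0 - M 0 1] : Fin 3 → ℝ)) = 4 * M.det - 4 * ((1 / 2 : ℝ) • (M + Mᵀ)).det := by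
  simp only [Matrix.det_fin_three, dotProduct, mulVec, Fin.sum_univ_three, Matrix.smul_apply,
    Matrix.add_apply, Matrix.transpose_apply, smul_eq_mul, Matrix.cons_val_zero,
    Matrix.cons_val_one, Matrix.cons_val_two, Matrix.head_cons, Matrix.tail_cons]
  ring

/-- `‖S‖²_F = ½ ‖M‖²_F + ½ tr(M²)` for `S = ½ (M + Mᵀ)` (expand the squares). [folklore] -/
theorem sum_sq_half_add_transpose (M : Matrix (Fin 3) (Fin 3) ℝ) :
    ∑ i, ∑ j, ((1 / 2 : ℝ) • (M + Mᵀ)) i j ^ 2 =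
      (1 / 2) * ∑ i, ∑ j, M i j ^ 2 + (1 / 2) * (M * M).trace := by
  simp only [Matrix.trace, Matrix.diag, Matrix.mul_apply, Fin.sum_univ_three, Matrix.smul_apply,
    Matrix.add_apply, Matrix.transpose_apply, smul_eq_mul]
  ring

/-- `|ω|² = ‖M‖²_F − tr(M²)` for the vorticity vector of `M` (expand). [folklore] -/
theorem curlVec_dotProduct_self (M : Matrix (Fin 3) (Fin 3) ℝ) :
    (![M 2 1 - M 1 2, M 0 2 - M 2 0, M 1 0 - M 0 1] : Fin 3 → ℝ) ⬝ᵥ (![M 2 1 - M 1 2, M 0 2 - M 2 0, M 1 0 - M 0 1] : Fin 3 → ℝ) = ∑ i, ∑ j, M i j ^ 2 - (M * M).trace := by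
  simp only [Matrix.trace, Matrix.diag, Matrix.mul_apply, Fin.sum_univ_three, dotProduct,
    Matrix.cons_val_zero, Matrix.cons_val_one, Matrix.cons_val_two, Matrix.head_cons,
    Matrix.tail_cons]
  ring

/-- The sum of the squares of the entries of a real symmetric `3 × 3` matrix is the sum of the
squares of its eigenvalues (`tr(H²) = tr(D²)` after unitary diagonalisation). [folklore] -/
theorem sum_sq_eq_sum_eigenvalues_sq {H : Matrix (Fin 3) (Fin 3) ℝ} (hH : H.IsHermitian) :
    ∑ i, ∑ j, H i j ^ 2 = ∑ i, hH.eigenvalues i ^ 2 := by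
  -- `∑ᵢⱼ Hᵢⱼ² = tr(H * H)` (symmetry of `H`)
  have hsymm : ∀ i j, H j i = H i j := fun i j => by
    simpa using congrFun (congrFun hH.eq j) i |>.symm
  have h1 : ∑ i, ∑ j, H i j ^ 2 = (H * H).trace := by
    simp only [Matrix.trace, Matrix.diag, Matrix.mul_apply]
    refine Finset.sum_congr rfl fun i _ => Finset.sum_congr rfl fun j _ => ?_
    rw [hsymm i j, sq]
  -- diagonalise
  set U := hH.eigenvectorUnitary with hU
  set D : Matrix (Fin 3) (Fin 3) ℝ := diagonal (RCLike.ofReal ∘ hH.eigenvalues) with hD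
  have hHU : H = (U : Matrix (Fin 3) (Fin 3) ℝ) * D * star (U : Matrix (Fin 3) (Fin 3) ℝ) := by
    have := hH.spectral_theorem
    rwa [Unitary.conjStarAlgAut_apply] at this
  have hUU : star (U : Matrix (Fin 3) (Fin 3) ℝ) * (U : Matrix (Fin 3) (Fin 3) ℝ) = 1 :=
    Unitary.coe_star_mul_self U
  have h2 : (H * H).trace = (D * D).trace := by
    have e1 : H * H = (U : Matrix (Fin 3) (Fin 3) ℝ) * (D * D) * star (U : Matrix (Fin 3) (Fin 3) ℝ) := by
      conv_lhs => rw [hHU]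
      simp only [Matrix.mul_assoc]
      congr 1
      rw [← Matrix.mul_assoc (star (U : Matrix (Fin 3) (Fin 3) ℝ)), hUU, Matrix.one_mul,
        ← Matrix.mul_assoc]
    rw [e1, Matrix.trace_mul_comm, ← Matrix.mul_assoc, hUU, Matrix.one_mul]
  have h3 : (D * D).trace = ∑ i, hH.eigenvalues i ^ 2 := by
    rw [hD, diagonal_mul_diagonal, trace_diagonal]
    refine Finset.sum_congr rfl fun i _ => ?_
    simp [sq]
  rw [h1, h2, h3]

/-- **Middle-eigenvalue bound for the strain determinant.** If `tr M = 0`, `0 ≤ a`, and the middle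
eigenvalue of `2S = M + Mᵀ` (index `1` of Mathlib's decreasing `eigenvalues₀`) is `≤ 2a`, then
`−4 det S ≤ 2a ‖S‖²_F`, `S = ½(M + Mᵀ)`: with `λ₁ ≥ λ₂ ≥ λ₃`, `∑λᵢ = 0`, the inequality
`−4λ₁λ₂λ₃ ≤ 2λ₂⁺(λ₁² + λ₂² + λ₃²)` (if `λ₂ ≤ 0` the left side is `≤ 0`; if `λ₂ > 0` then
`λ₁(λ₁ + λ₂) ≤ λ₁² + λ₂² + λ₁λ₂`). [cite: Miller2019, §1 (−det S ≤ ½λ₂⁺|S|²)] -/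
theorem neg_det_half_add_transpose_le (M : Matrix (Fin 3) (Fin 3) ℝ) (htr : M.trace = 0) {a : ℝ}
    (ha : 0 ≤ a) (hmid : (Matrix.isHermitian_add_transpose_self M).eigenvalues₀ 1 ≤ 2 * a) :
    -4 * ((1 / 2 : ℝ) • (M + Mᵀ)).det ≤ 2 * a * ∑ i, ∑ j, ((1 / 2 : ℝ) • (M + Mᵀ)) i j ^ 2 := by
  set H : Matrix (Fin 3) (Fin 3) ℝ := M + Mᵀ with hHdef
  have hH : H.IsHermitian := Matrix.isHermitian_add_transpose_self M
  set μ := hH.eigenvalues₀ with hμ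
  -- det, Frobenius sum and trace of `H` through the sorted eigenvalues
  have hprod : H.det = μ 0 * μ 1 * μ 2 := by
    have h := hH.det_eq_prod_eigenvalues
    simp only [RCLike.ofReal_real_eq_id, id_eq] at h
    rw [h]
    have h' : ∏ i, hH.eigenvalues i = ∏ j, hH.eigenvalues₀ j := by
      unfold Matrix.IsHermitian.eigenvalues
      exact Equiv.prod_comp (Fintype.equivOfCardEq (Fintype.card_fin _)).symm (fun j => hH.eigenvalues₀ j)
    rw [h']
    exact Fin.prod_univ_three _
  have hsumsq : ∑ i, ∑ j, H i j ^ 2 = μ 0 ^ 2 + μ 1 ^ 2 + μ 2 ^ 2 := by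
    rw [sum_sq_eq_sum_eigenvalues_sq hH]
    have h' : ∑ i, hH.eigenvalues i ^ 2 = ∑ j, hH.eigenvalues₀ j ^ 2 := by
      unfold Matrix.IsHermitian.eigenvalues
      exact Equiv.sum_comp (Fintype.equivOfCardEq (Fintype.card_fin _)).symm (fun j => hH.eigenvalues₀ j ^ 2)
    rw [h']
    exact Fin.sum_univ_three _
  have htrace : μ 0 + μ 1 + μ 2 = 0 := by
    have h := hH.trace_eq_sum_eigenvalues
    simp only [RCLike.ofReal_real_eq_id, id_eq] at h
    have hH0 : H.trace = 0 := by
      rw [hHdef, Matrix.trace_add, Matrix.trace_transpose, htr, add_zero]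
    rw [hH0] at h
    have h' : ∑ i, hH.eigenvalues i = ∑ j, hH.eigenvalues₀ j := by
      unfold Matrix.IsHermitian.eigenvalues
      exact Equiv.sum_comp (Fintype.equivOfCardEq (Fintype.card_fin _)).symm (fun j => hH.eigenvalues₀ j)
    have h'' : ∑ j, hH.eigenvalues₀ j = μ 0 + μ 1 + μ 2 := Fin.sum_univ_three _
    linarith
  have h01 : μ 1 ≤ μ 0 := hH.eigenvalues₀_antitone (by decide)
  have h12 : μ 2 ≤ μ 1 := hH.eigenvalues₀_antitone (by decide)
  -- reduce to the eigenvalue inequality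
  have hdetS : ((1 / 2 : ℝ) • (M + Mᵀ)).det = (1 / 8) * (μ 0 * μ 1 * μ 2) := by
    rw [show (M + Mᵀ) = H from rfl, Matrix.det_smul, hprod]
    have h8 : (1 / 2 : ℝ) ^ Fintype.card (Fin 3) = 1 / 8 := by
      rw [Fintype.card_fin]; norm_num
    rw [h8]
  have hsqS : ∑ i, ∑ j, ((1 / 2 : ℝ) • (M + Mᵀ)) i j ^ 2 = (1 / 4) * (μ 0 ^ 2 + μ 1 ^ 2 + μ 2 ^ 2) := by
    rw [← hsumsq, Finset.mul_sum]
    refine Finset.sum_congr rfl fun i _ => ?_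
    rw [Finset.mul_sum]
    refine Finset.sum_congr rfl fun j _ => ?_
    rw [show (M + Mᵀ) = H from rfl, Matrix.smul_apply, smul_eq_mul]
    ring
  rw [hdetS, hsqS]
  -- `-(1/2) μ₀μ₁μ₂ ≤ (a/2)(μ₀² + μ₁² + μ₂²)` with `μ₂ = -μ₀ - μ₁`
  have hμ2 : μ 2 = -μ 0 - μ 1 := by linarith
  rw [hμ2]
  have hμ0 : 0 ≤ μ 0 := by linarith
  rcases le_or_gt (μ 1) 0 with hneg | hpos
  · -- `μ₁ ≤ 0`: the left side is `≤ 0`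
    have hsum01 : 0 ≤ μ 0 + μ 1 := by linarith
    nlinarith [mul_nonneg hμ0 hsum01, mul_nonneg (mul_nonneg hμ0 hsum01) (neg_nonneg.2 hneg),
      sq_nonneg (μ 0), sq_nonneg (μ 1), sq_nonneg (μ 0 + μ 1), mul_nonneg ha (sq_nonneg (μ 0)),
      mul_nonneg ha (sq_nonneg (μ 1)), mul_nonneg ha (sq_nonneg (μ 0 + μ 1))]
  · -- `0 < μ₁ ≤ 2a`
    have hsum01 : 0 ≤ μ 0 + μ 1 := by linarith
    have hk1 : μ 1 * (μ 0 * (μ 0 + μ 1)) ≤ 2 * a * (μ 0 * (μ 0 + μ 1)) :=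
      mul_le_mul_of_nonneg_right hmid (mul_nonneg hμ0 hsum01)
    have hk2 : 0 ≤ a * μ 1 ^ 2 := mul_nonneg ha (sq_nonneg _)
    nlinarith [hk1, hk2]

/-- **Pointwise production bound** (matrix form): for a trace-free `M`, `0 ≤ a`, and middle strain
eigenvalue `≤ a` (i.e. `eigenvalues₀ 1 (M + Mᵀ) ≤ 2a`),
`ω·Mω ≤ 4 det M + a (‖M‖²_F + tr(M²))` — sign law, middle-eigenvalue bound and
`‖S‖²_F = ½‖M‖²_F + ½tr(M²)`. [cite: Miller2019, §1 (−det S ≤ ½λ₂⁺|S|²)] -/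
theorem curlVec_dotProduct_mulVec_le (M : Matrix (Fin 3) (Fin 3) ℝ) (htr : M.trace = 0) {a : ℝ}
    (ha : 0 ≤ a) (hmid : (Matrix.isHermitian_add_transpose_self M).eigenvalues₀ 1 ≤ 2 * a) :
    (![M 2 1 - M 1 2, M 0 2 - M 2 0, M 1 0 - M 0 1] : Fin 3 → ℝ) ⬝ᵥ (M *ᵥ (![M 2 1 - M 1 2, M 0 2 - M 2 0, M 1 0 - M 0 1] : Fin 3 → ℝ)) ≤ 4 * M.det + a * (∑ i, ∑ j, M i j ^ 2 + (M * M).trace) := by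
  rw [curlVec_dotProduct_mulVec_eq_det]
  have h := neg_det_half_add_transpose_le M htr ha hmid
  rw [sum_sq_half_add_transpose] at h
  nlinarith [h]

/-- `Fin.cast` along `Fintype.card (Fin 3) = 3` fixes the index `1`. [folklore] -/
theorem fin_cast_card_fin_three_one : Fin.cast (Fintype.card_fin 3).symm (1 : Fin 3) = 1 :=
  Fin.ext (by simp)

/-- **Pointwise production bound for a velocity gradient** (operator form of
`curlVec_dotProduct_mulVec_le`): for `A = ∇v(y)` trace free (`div v (y) = 0`), `0 ≤ a`, and middle
principal strain `λ₂(½(A + Aᵀ)) ≤ a` (`strainEigenvalues A _ 1 ≤ a`), the local enstrophy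
production satisfies `⟪A ω, ω⟫ ≤ 4 det A + a (‖A‖²_F + tr(A ∘ A))`, `ω = curl v (y)`.
[cite: Miller2019, §1 (−det S ≤ ½λ₂⁺|S|²)] -/
theorem inner_fderiv_curl_le {v : ℝ³ → ℝ³} {y : ℝ³} {a : ℝ} (ha : 0 ≤ a)
    (htr : LinearMap.trace ℝ ℝ³ (fderiv ℝ v y : ℝ³ →ₗ[ℝ] ℝ³) = 0)
    (hmid : strainEigenvalues (fderiv ℝ v y : ℝ³ →ₗ[ℝ] ℝ³) finrank_euclideanSpace_fin 1 ≤ a) :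
    ⟪fderiv ℝ v y (curl v y), curl v y⟫ ≤
      4 * LinearMap.det (fderiv ℝ v y : ℝ³ →ₗ[ℝ] ℝ³) +
        a * (frobeniusNormSq (fderiv ℝ v y) +
          LinearMap.trace ℝ ℝ³ ((fderiv ℝ v y : ℝ³ →ₗ[ℝ] ℝ³) ∘ₗ (fderiv ℝ v y : ℝ³ →ₗ[ℝ] ℝ³))) := by
  -- the hypotheses in matrix form, `M = stdMatrix ∇v(y)`
  have htrM : (stdMatrix (fderiv ℝ v y : ℝ³ →ₗ[ℝ] ℝ³)).trace = 0 := by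
    rw [trace_stdMatrix]; exact htr
  have hmidM : (Matrix.isHermitian_add_transpose_self
      (stdMatrix (fderiv ℝ v y : ℝ³ →ₗ[ℝ] ℝ³))).eigenvalues₀ 1 ≤ 2 * a := by
    have h := strainEigenvalues_eq_eigenvalues₀ (fderiv ℝ v y : ℝ³ →ₗ[ℝ] ℝ³) 1
    rw [fin_cast_card_fin_three_one] at h
    rw [h] at hmid
    linarith
  have key := curlVec_dotProduct_mulVec_le _ htrM ha hmidM
  -- translate the four quantities
  have hAapp : ∀ w : Fin 3 → ℝ, fderiv ℝ v y (WithLp.toLp 2 w) =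
      WithLp.toLp 2 (stdMatrix (fderiv ℝ v y : ℝ³ →ₗ[ℝ] ℝ³) *ᵥ w) := by
    intro w
    have h := congrArg (fun L : ℝ³ →ₗ[ℝ] ℝ³ => L (WithLp.toLp 2 w))
      (toEuclideanLin_stdMatrix (fderiv ℝ v y : ℝ³ →ₗ[ℝ] ℝ³))
    simp only [ContinuousLinearMap.coe_coe] at h
    rw [← h]
    exact Matrix.toLpLin_apply 2 2 _ _
  have hinner : ∀ w : Fin 3 → ℝ, ⟪fderiv ℝ v y (WithLp.toLp 2 w), WithLp.toLp 2 w⟫ =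
      w ⬝ᵥ (stdMatrix (fderiv ℝ v y : ℝ³ →ₗ[ℝ] ℝ³) *ᵥ w) := by
    intro w
    rw [hAapp, EuclideanSpace.inner_eq_star_dotProduct, WithLp.ofLp_toLp, WithLp.ofLp_toLp,
      star_trivial, dotProduct_comm]
  have hdet : LinearMap.det (fderiv ℝ v y : ℝ³ →ₗ[ℝ] ℝ³) =
      (stdMatrix (fderiv ℝ v y : ℝ³ →ₗ[ℝ] ℝ³)).det :=
    (LinearMap.det_toMatrix (EuclideanSpace.basisFun (Fin 3) ℝ).toBasis
      (fderiv ℝ v y : ℝ³ →ₗ[ℝ] ℝ³)).symm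
  have hfrob := frobeniusNormSq_eq_sum_sq_stdMatrix (fderiv ℝ v y)
  have htr2 : LinearMap.trace ℝ ℝ³ ((fderiv ℝ v y : ℝ³ →ₗ[ℝ] ℝ³) ∘ₗ (fderiv ℝ v y : ℝ³ →ₗ[ℝ] ℝ³)) =
      (stdMatrix (fderiv ℝ v y : ℝ³ →ₗ[ℝ] ℝ³) * stdMatrix (fderiv ℝ v y : ℝ³ →ₗ[ℝ] ℝ³)).trace := by
    rw [← trace_stdMatrix, stdMatrix_comp]
  rw [curl_eq_stdMatrix v y, hinner, hdet, hfrob, htr2]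
  exact key

/-- **`|ω|² = ‖∇v‖²_F − tr(∇v ∘ ∇v)`** at a point (operator form of `curlVec_dotProduct_self`;
Majda–Bertozzi, §1.2, (1.22)–(1.24)). [folklore] -/
theorem norm_curl_sq_eq_frobeniusNormSq_sub_trace (v : ℝ³ → ℝ³) (y : ℝ³) :
    ‖curl v y‖ ^ 2 = frobeniusNormSq (fderiv ℝ v y) -
      LinearMap.trace ℝ ℝ³ ((fderiv ℝ v y : ℝ³ →ₗ[ℝ] ℝ³) ∘ₗ (fderiv ℝ v y : ℝ³ →ₗ[ℝ] ℝ³)) := by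
  have htr2 : LinearMap.trace ℝ ℝ³ ((fderiv ℝ v y : ℝ³ →ₗ[ℝ] ℝ³) ∘ₗ (fderiv ℝ v y : ℝ³ →ₗ[ℝ] ℝ³)) =
      (stdMatrix (fderiv ℝ v y : ℝ³ →ₗ[ℝ] ℝ³) * stdMatrix (fderiv ℝ v y : ℝ³ →ₗ[ℝ] ℝ³)).trace := by
    rw [← trace_stdMatrix, stdMatrix_comp]
  have hn : ∀ w : Fin 3 → ℝ, ‖WithLp.toLp 2 w‖ ^ 2 = w ⬝ᵥ w := by
    intro w
    rw [← real_inner_self_eq_norm_sq, EuclideanSpace.inner_eq_star_dotProduct, WithLp.ofLp_toLp,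
      star_trivial]
  rw [curl_eq_stdMatrix v y, hn, frobeniusNormSq_eq_sum_sq_stdMatrix, htr2]
  exact curlVec_dotProduct_self _

end Summit.NavierStokesRegularity.NavierStokesRegularity.Theorems

end
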